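import Literature.Dynamics.Contraction.AdditiveCompound
import Mathlib.LinearAlgebra.ExteriorPower.Pairing
import Mathlib.LinearAlgebra.ExteriorPower.Basis
import Mathlib.LinearAlgebra.Eigenspace.Basic
import Mathlib.LinearAlgebra.Matrix.Determinant.Basic
import Mathlib.Analysis.InnerProductSpace.Calculus
import Mathlib.Analysis.InnerProductSpace.Continuous
import Mathlib.Analysis.ODE.Gronwall
import HarnessLib

/-!
# The Gram inner product on `⋀²`, 2-volumes, and exponential decay of areas (`2`-contraction)

Topic `Literature/Dynamics/Contraction`; companion to `AdditiveCompound.lean` (the second additive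
compound `f^{[2]}`, `secondAdditiveCompound`), delivering the analytic half of definition request
`defn-SecondAdditiveCompound` (route `Summits/NavierStokesRegularity/…/DulacContraction`, support
item `RelativeContractionEngine`, foreseen child `LinearAreaContraction`): the inner product on
`⋀² H`, the identity `d/dt |x₁ ∧ x₂|² = 2 ⟨A^{[2]} (x₁ ∧ x₂), x₁ ∧ x₂⟩` for solutions of
`ẋ = A(t) x`, and the 2-volume (Gram determinant) decay lemma.

**Sources.**  Constantin–Foias (1988), Ch. 13 "Exponential decay of volume elements": the
scalar product on `Λᴺ H`, `(v₁ ∧ ⋯ ∧ v_N ; w₁ ∧ ⋯ ∧ w_N) = det (vᵢ, wⱼ)` (13.22); the operator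
`T_N = T ∧ I ∧ ⋯ + ⋯ + I ∧ ⋯ ∧ T` (our `secondAdditiveCompound` for `N = 2`); Lemma 13.3
`(T_N ξ ; ξ) = |ξ|² Tr (T Q(v₁,…,v_N))` (13.23), `Q` the orthogonal projector onto `span {vᵢ}`;
Lemma 13.4 `½ d/dt |v₁ ∧ ⋯ ∧ v_N|² + |v₁ ∧ ⋯ ∧ v_N|² Tr (A(t) Q) = 0` (13.24), whence (13.29).
Wu–Kanevskiy–Margaliot, arXiv:2008.10321, §3.1: Definition 1 (`k`-order contraction
`|∧ᵢ w(t,aⁱ)| ≤ e^{-ηt} |∧ᵢ aⁱ|`), Proposition 3 (`μ(A^{[k]}(t)) ≤ -η` implies it, via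
`ġ = A^{[k]} g`); §2.3 (spectrum of `A^{[k]}`); §2.4, `μ₂(A^{[k]}) = Σ_{i ≤ k} λᵢ((A + Aᵀ)/2)`.
Muldowney, Rocky Mountain J. Math. 20 (1990), §2 (compound equations `y' = A^{[2]} y`).

**Contents** (namespace `Literature.Dynamics.Contraction`).
* `gramForm B : ⋀[R]^2 M →ₗ[R] ⋀[R]^2 M →ₗ[R] R`, the bilinear form induced on `⋀²` by a bilinear
  form `B` on `M` — Mathlib's `exteriorPower.pairingDual` composed with `exteriorPower.map 2 B` — with
  `gramForm B (x ∧ y) (u ∧ v) = B x u · B y v − B x v · B y u` (`gramForm_wedge`, (13.22) for `N = 2`),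
  symmetric when `B` is (`gramForm_flip`, `gramForm_comm`), and the quadratic form of `f^{[2]}` on a
  decomposable 2-vector (`gramForm_secondAdditiveCompound_wedge`).
* On a real inner product space `E`: `gramArea x y = ‖x‖² ‖y‖² − ⟪x, y⟫² = |x ∧ y|²`, the Gram
  determinant (`gramArea_eq_det`, `gramForm_wedge_self`), nonnegative (Cauchy–Schwarz), homogeneous,
  shear-invariant; for an orthonormal pair `⟨f^{[2]}(u ∧ v), u ∧ v⟩ = ⟪f u, u⟫ + ⟪f v, v⟫`
  (`gramForm_secondAdditiveCompound_of_orthonormal`, Lemma 13.3 for `N = 2`: the trace of `f`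
  compressed to `span {u, v}`), and the KY FAN direction used for decay: if
  `⟪f u, u⟫ + ⟪f v, v⟫ ≤ κ` for every orthonormal pair then `⟨f^{[2]} ξ, ξ⟩ ≤ κ |ξ|²` for every
  decomposable `ξ = x ∧ y` (`gramForm_secondAdditiveCompound_le_of_orthonormal`; in `ℝⁿ` the best `κ`
  is `λ₁ + λ₂` of `(A + Aᵀ)/2`, i.e. `μ₂(A^{[2]})`).
* `hasDerivWithinAt_gramArea` / `hasDerivWithinAt_gramArea_of_ode`: along `ẋ = A x`, `ẏ = A y`,
  `d/dt |x ∧ y|² = 2 ⟨A^{[2]}(x ∧ y), x ∧ y⟩` (Lemma 13.4 / the compound equation `ż = A^{[2]} z`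
  tested against `z`).
* `gramArea_le_mul_exp`: if `⟨A(t)^{[2]} ξ, ξ⟩ ≤ κ |ξ|²` on decomposables for `t ∈ [0, T)` then
  `|x(t) ∧ y(t)|² ≤ |x(0) ∧ y(0)|² e^{2κt}` on `[0, T]` (Grönwall); `gramArea_le_mul_exp_of_orthonormal`
  (hypothesis in the trace / Ky Fan form) and `sqrt_gramArea_le_mul_exp`
  (`|x(t) ∧ y(t)| ≤ e^{κt} |x(0) ∧ y(0)|`, Definition 1 with `η = -κ`).
* `wedge_ne_zero_of_linearIndependent` (`x ∧ y ≠ 0` for independent `x, y` over a field) and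
  `hasEigenvalue_secondAdditiveCompound`: independent eigenvectors `f x = a x`, `f y = b y` make
  `a + b` an EIGENVALUE of `f^{[2]}` — the inclusion `{λᵢ + λⱼ} ⊆ σ(f^{[2]})` (§2.3).
* How a logarithmic-norm bound feeds the trace condition (`⟪A u, u⟫ ≤ μ(A) ‖u‖²`) and the
  Dahlquist–Lozinskiĭ bound `‖e^{ta}‖ ≤ e^{t μ(a)}` are in `LogNormBounds.lean`.

**Not here.** A norm on the abstract module `⋀[ℝ]^2 E` (so `μ(A^{[2]})` as a `logNorm` is not
formed; the decay hypothesis is the quadratic-form bound it unfolds to on decomposable 2-vectors);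
the converse Ky Fan inequality (`sup = λ₁ + λ₂`) and `σ(f^{[2]}) ⊆ {λᵢ + λⱼ}`; `k > 2`.

## Mathlib search

`exteriorPower.pairingDual`, `pairingDual_ιMulti_ιMulti`, `exteriorPower.map_apply_ιMulti`,
`ιMulti_family_linearIndependent_field`, `Matrix.det_fin_two(_of)`; `HasDerivWithinAt.inner`,
`ContinuousOn.inner`; `le_gronwallBound_of_liminf_deriv_right_le`, `gronwallBound_ε0`,
`HasDerivWithinAt.liminf_right_slope_le`.  No Gram determinant / 2-volume / volume-decay lemma in
Mathlib or Literature.  No named fact is introduced; everything below is proved.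

## References

* P. Constantin, C. Foias, *Navier–Stokes Equations*, Chicago Lectures in Mathematics, University
  of Chicago Press (1988), Ch. 13, (13.22)–(13.24), Lemmas 13.3–13.4, (13.29). [ConstantinFoias1988]
* C. Wu, I. Kanevskiy, M. Margaliot, *k-contraction: theory and applications*, arXiv:2008.10321,
  §2.4, §3.1 (Definition 1, Proposition 3, Corollary 1). [WuKanevskiyMargaliot2020]
* J. S. Muldowney, *Compound matrices and ordinary differential equations*, Rocky Mountain J. Math.
  20 (1990) 857–872, §2. [Muldowney1990]
-/

noncomputable section

open scoped Topology InnerProductSpace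
open Set Filter exteriorPower

namespace Literature.Dynamics.Contraction

/-! ### The Gram bilinear form on `⋀[R]^2 M` -/

section Algebra

variable {R : Type*} [CommRing R] {M : Type*} [AddCommGroup M] [Module R M]

/-- **The Gram form on `⋀²`**: the bilinear form on `⋀[R]^2 M` induced by a bilinear form
`B : M → M → R`, `⟨x ∧ y, u ∧ v⟩ = det [B x u, B x v; B y u, B y v]`; for `B` the inner product of a
Hilbert space this is the scalar product of `Λ² H`.  Built as Mathlib's pairing
`⋀²(M^*) → (⋀² M)^*` after `⋀²` of the map `B : M → M^*`.
[cite: ConstantinFoias1988, Ch. 13 (13.22)] -/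
def gramForm (B : M →ₗ[R] M →ₗ[R] R) : ⋀[R]^2 M →ₗ[R] ⋀[R]^2 M →ₗ[R] R :=
  pairingDual R M 2 ∘ₗ exteriorPower.map 2 B

/-- **`⟨x ∧ y, u ∧ v⟩ = B x u · B y v − B x v · B y u`** (the `2 × 2` Gram determinant).
[cite: ConstantinFoias1988, Ch. 13 (13.22)] -/
@[simp] theorem gramForm_wedge (B : M →ₗ[R] M →ₗ[R] R) (x y u v : M) :
    gramForm B (wedge x y) (wedge u v) = B x u * B y v - B x v * B y u := by
  simp only [gramForm, LinearMap.coe_comp, Function.comp_apply, wedge_def, map_apply_ιMulti,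
    pairingDual_ιMulti_ιMulti, Matrix.det_fin_two, Matrix.of_apply, Matrix.cons_val_zero,
    Matrix.cons_val_one]
  ring

/-- The Gram form of a symmetric bilinear form is symmetric. [folklore] -/
theorem gramForm_flip (B : M →ₗ[R] M →ₗ[R] R) (hB : ∀ x y, B x y = B y x) :
    (gramForm B).flip = gramForm B := by
  refine hom_ext_wedge fun u v => ?_
  refine hom_ext_wedge fun x y => ?_
  rw [LinearMap.flip_apply, gramForm_wedge, gramForm_wedge, hB u x, hB v y, hB u y, hB v x]
  ring

/-- `⟨ξ, η⟩ = ⟨η, ξ⟩` for the Gram form of a symmetric bilinear form. [folklore] -/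
theorem gramForm_comm (B : M →ₗ[R] M →ₗ[R] R) (hB : ∀ x y, B x y = B y x) (ξ η : ⋀[R]^2 M) :
    gramForm B ξ η = gramForm B η ξ := by
  have h := congrArg (fun F : ⋀[R]^2 M →ₗ[R] ⋀[R]^2 M →ₗ[R] R => F η ξ) (gramForm_flip B hB)
  simpa only [LinearMap.flip_apply] using h

/-- **The quadratic form of `f^{[2]}` on a decomposable 2-vector**:
`⟨f^{[2]}(x ∧ y), x ∧ y⟩ = ⟨f x ∧ y + x ∧ f y, x ∧ y⟩` expanded by (13.22).
[cite: ConstantinFoias1988, Ch. 13 Lemma 13.3] -/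
theorem gramForm_secondAdditiveCompound_wedge (B : M →ₗ[R] M →ₗ[R] R) (f : M →ₗ[R] M)
    (x y : M) :
    gramForm B (secondAdditiveCompound f (wedge x y)) (wedge x y) =
      B (f x) x * B y y - B (f x) y * B y x + (B x x * B (f y) y - B x y * B (f y) x) := by
  rw [secondAdditiveCompound_wedge, map_add, LinearMap.add_apply, gramForm_wedge, gramForm_wedge]

end Algebra

/-! ### 2-volumes in a real inner product space -/

section InnerProduct

variable {E : Type*} [NormedAddCommGroup E] [InnerProductSpace ℝ E]

/-- **The squared 2-volume `|x ∧ y|² = ‖x‖² ‖y‖² − ⟪x, y⟫²`** (Gram determinant) of the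
parallelogram spanned by `x, y` — the square of the norm of `x ∧ y` in `Λ² E`.
[cite: ConstantinFoias1988, Ch. 13 (13.22)] [cite: WuKanevskiyMargaliot2020, §3.1 Definition 1] -/
def gramArea (x y : E) : ℝ := ‖x‖ ^ 2 * ‖y‖ ^ 2 - ⟪x, y⟫_ℝ ^ 2

/-- Unfolding lemma for `gramArea`. [folklore] -/
theorem gramArea_def (x y : E) : gramArea x y = ‖x‖ ^ 2 * ‖y‖ ^ 2 - ⟪x, y⟫_ℝ ^ 2 := rfl

/-- `|x ∧ y|²` is the Gram determinant `det [⟪x,x⟫ ⟪x,y⟫; ⟪y,x⟫ ⟪y,y⟫]`.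
[cite: ConstantinFoias1988, Ch. 13 (13.22)] -/
theorem gramArea_eq_det (x y : E) :
    gramArea x y = Matrix.det !![⟪x, x⟫_ℝ, ⟪x, y⟫_ℝ; ⟪y, x⟫_ℝ, ⟪y, y⟫_ℝ] := by
  rw [Matrix.det_fin_two_of, gramArea, real_inner_self_eq_norm_sq, real_inner_self_eq_norm_sq,
    real_inner_comm x y]
  ring

/-- `|x ∧ y|² = ⟨x ∧ y, x ∧ y⟩` for the Gram form of the inner product.
[cite: ConstantinFoias1988, Ch. 13 (13.22)] -/
theorem gramForm_wedge_self (x y : E) :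
    gramForm (innerₗ E) (wedge x y) (wedge x y) = gramArea x y := by
  rw [gramForm_wedge, innerₗ_apply_apply, innerₗ_apply_apply, innerₗ_apply_apply,
    innerₗ_apply_apply, real_inner_self_eq_norm_sq, real_inner_self_eq_norm_sq,
    real_inner_comm x y, gramArea]
  ring

/-- `|x ∧ y|² = |y ∧ x|²`. [folklore] -/
theorem gramArea_comm (x y : E) : gramArea x y = gramArea y x := by
  rw [gramArea, gramArea, real_inner_comm x y]
  ring

/-- **`0 ≤ |x ∧ y|²`** (Cauchy–Schwarz). [folklore] -/
theorem gramArea_nonneg (x y : E) : 0 ≤ gramArea x y := by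
  have h := real_inner_mul_inner_self_le x y
  rw [real_inner_self_eq_norm_sq, real_inner_self_eq_norm_sq] at h
  rw [gramArea, sq ⟪x, y⟫_ℝ]
  linarith

/-- `|x ∧ x|² = 0`. [folklore] -/
theorem gramArea_self (x : E) : gramArea x x = 0 := by
  rw [gramArea, real_inner_self_eq_norm_sq]
  ring

/-- `|0 ∧ y|² = 0`. [folklore] -/
@[simp] theorem gramArea_zero_left (y : E) : gramArea 0 y = 0 := by
  simp [gramArea]

/-- `|x ∧ 0|² = 0`. [folklore] -/
@[simp] theorem gramArea_zero_right (x : E) : gramArea x 0 = 0 := by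
  simp [gramArea]

/-- `|(c x) ∧ y|² = c² |x ∧ y|²`. [folklore] -/
theorem gramArea_smul_left (c : ℝ) (x y : E) : gramArea (c • x) y = c ^ 2 * gramArea x y := by
  rw [gramArea, gramArea, norm_smul, real_inner_smul_left, Real.norm_eq_abs, mul_pow, sq_abs]
  ring

/-- `|x ∧ (c y)|² = c² |x ∧ y|²`. [folklore] -/
theorem gramArea_smul_right (c : ℝ) (x y : E) : gramArea x (c • y) = c ^ 2 * gramArea x y := by
  rw [gramArea_comm, gramArea_smul_left, gramArea_comm]

/-- **Shear invariance** `|x ∧ (y + c x)|² = |x ∧ y|²`. [folklore] -/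
theorem gramArea_add_smul_right (x y : E) (c : ℝ) : gramArea x (y + c • x) = gramArea x y := by
  simp only [gramArea, norm_add_sq_real, inner_add_right, real_inner_smul_right, norm_smul,
    real_inner_self_eq_norm_sq, Real.norm_eq_abs, mul_pow, sq_abs, real_inner_comm x y]
  ring

/-- For orthogonal `x ⟂ w`, `|x ∧ w|² = ‖x‖² ‖w‖²`. [folklore] -/
theorem gramArea_of_inner_eq_zero {x w : E} (h : ⟪x, w⟫_ℝ = 0) :
    gramArea x w = ‖x‖ ^ 2 * ‖w‖ ^ 2 := by
  rw [gramArea, h]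
  ring

/-- Two-vector Gram–Schmidt: for `x ≠ 0`, every `y` is `w + c x` with `w ⟂ x`. [folklore] -/
theorem exists_eq_add_smul_of_ne_zero {x : E} (hx : x ≠ 0) (y : E) :
    ∃ (w : E) (c : ℝ), y = w + c • x ∧ ⟪x, w⟫_ℝ = 0 := by
  refine ⟨y - (⟪x, y⟫_ℝ / ‖x‖ ^ 2) • x, ⟪x, y⟫_ℝ / ‖x‖ ^ 2, (sub_add_cancel _ _).symm, ?_⟩
  have hxn : ‖x‖ ^ 2 ≠ 0 := pow_ne_zero 2 (norm_ne_zero_iff.mpr hx)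
  rw [inner_sub_right, real_inner_smul_right, real_inner_self_eq_norm_sq, div_mul_cancel₀ _ hxn,
    sub_self]

/-- **The trace formula on an orthonormal pair** (Lemma 13.3 for `N = 2`): for orthonormal `u, v`,
`⟨f^{[2]}(u ∧ v), u ∧ v⟩ = ⟪f u, u⟫ + ⟪f v, v⟫ = Tr (f ∘ Q_{span{u,v}})`.
[cite: ConstantinFoias1988, Ch. 13 Lemma 13.3] -/
theorem gramForm_secondAdditiveCompound_of_orthonormal (f : E →ₗ[ℝ] E) {u v : E}
    (hu : ‖u‖ = 1) (hv : ‖v‖ = 1) (huv : ⟪u, v⟫_ℝ = 0) :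
    gramForm (innerₗ E) (secondAdditiveCompound f (wedge u v)) (wedge u v) =
      ⟪f u, u⟫_ℝ + ⟪f v, v⟫_ℝ := by
  rw [gramForm_secondAdditiveCompound_wedge]
  simp only [innerₗ_apply_apply, real_inner_self_eq_norm_sq, hu, hv, huv, real_inner_comm u v,
    one_pow, mul_one, one_mul, mul_zero, zero_mul, sub_zero]

/-- **Ky Fan direction of `μ₂(A^{[2]}) = λ₁ + λ₂`**: if `⟪f u, u⟫ + ⟪f v, v⟫ ≤ κ` for every
orthonormal pair `u, v`, then `⟨f^{[2]} ξ, ξ⟩ ≤ κ |ξ|²` for every decomposable `ξ = x ∧ y`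
(Gram–Schmidt inside `span {x, y}`; both sides scale by `det²`).
[cite: WuKanevskiyMargaliot2020, §2.4] [cite: ConstantinFoias1988, Ch. 13 (13.26)–(13.27)] -/
theorem gramForm_secondAdditiveCompound_le_of_orthonormal (f : E →ₗ[ℝ] E) {κ : ℝ}
    (hf : ∀ u v : E, ‖u‖ = 1 → ‖v‖ = 1 → ⟪u, v⟫_ℝ = 0 → ⟪f u, u⟫_ℝ + ⟪f v, v⟫_ℝ ≤ κ)
    (x y : E) :
    gramForm (innerₗ E) (secondAdditiveCompound f (wedge x y)) (wedge x y) ≤ κ * gramArea x y := by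
  by_cases hx : x = 0
  · subst hx
    rw [wedge_zero_left, map_zero, gramArea_zero_left, mul_zero]
  obtain ⟨w, c, rfl, hxw⟩ := exists_eq_add_smul_of_ne_zero hx y
  have hwedge : wedge (R := ℝ) x (w + c • x) = wedge x w := by
    rw [wedge_add_right, wedge_smul_right, wedge_self, smul_zero, add_zero]
  have hG : gramArea x (w + c • x) = ‖x‖ ^ 2 * ‖w‖ ^ 2 := by
    rw [gramArea_add_smul_right, gramArea_of_inner_eq_zero hxw]
  rw [hwedge, hG]
  by_cases hw : w = 0
  · subst hw
    rw [wedge_zero_right, map_zero]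
    simp
  have hxn : ‖x‖ ≠ 0 := norm_ne_zero_iff.mpr hx
  have hwn : ‖w‖ ≠ 0 := norm_ne_zero_iff.mpr hw
  -- the orthonormal pair `u = x/‖x‖`, `v = w/‖w‖`
  have hu : ‖‖x‖⁻¹ • x‖ = 1 := by rw [norm_smul, norm_inv, norm_norm, inv_mul_cancel₀ hxn]
  have hv : ‖‖w‖⁻¹ • w‖ = 1 := by rw [norm_smul, norm_inv, norm_norm, inv_mul_cancel₀ hwn]
  have huv : ⟪‖x‖⁻¹ • x, ‖w‖⁻¹ • w⟫_ℝ = 0 := by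
    rw [real_inner_smul_left, real_inner_smul_right, hxw, mul_zero, mul_zero]
  have hdec : wedge (R := ℝ) x w = (‖x‖ * ‖w‖) • wedge (‖x‖⁻¹ • x) (‖w‖⁻¹ • w) := by
    rw [wedge_smul_left, wedge_smul_right, smul_smul, smul_smul,
      show ‖x‖ * ‖w‖ * ‖x‖⁻¹ * ‖w‖⁻¹ = 1 by field_simp, one_smul]
  have hQ := hf _ _ hu hv huv
  simp only [hdec, map_smul, LinearMap.smul_apply, smul_eq_mul]
  rw [gramForm_secondAdditiveCompound_of_orthonormal f hu hv huv]
  have hs : 0 ≤ ‖x‖ * ‖w‖ * (‖x‖ * ‖w‖) := mul_self_nonneg _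
  calc ‖x‖ * ‖w‖ * (‖x‖ * ‖w‖ * (⟪f (‖x‖⁻¹ • x), ‖x‖⁻¹ • x⟫_ℝ + ⟪f (‖w‖⁻¹ • w), ‖w‖⁻¹ • w⟫_ℝ))
        = ‖x‖ * ‖w‖ * (‖x‖ * ‖w‖) *
            (⟪f (‖x‖⁻¹ • x), ‖x‖⁻¹ • x⟫_ℝ + ⟪f (‖w‖⁻¹ • w), ‖w‖⁻¹ • w⟫_ℝ) := by ring
    _ ≤ ‖x‖ * ‖w‖ * (‖x‖ * ‖w‖) * κ := mul_le_mul_of_nonneg_left hQ hs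
    _ = κ * (‖x‖ ^ 2 * ‖w‖ ^ 2) := by ring

/-! ### The compound equation tested against `x ∧ y`, and decay of 2-volumes -/

/-- **`d/dt |x ∧ y|² = 2 ⟨x' ∧ y + x ∧ y', x ∧ y⟩`** (product rule in `Λ² E`, written through the
Gram form). [cite: ConstantinFoias1988, Ch. 13 Lemma 13.4] -/
theorem hasDerivWithinAt_gramArea {x y : ℝ → E} {x' y' : E} {s : Set ℝ} {t : ℝ}
    (hx : HasDerivWithinAt x x' s t) (hy : HasDerivWithinAt y y' s t) :
    HasDerivWithinAt (fun τ => gramArea (x τ) (y τ))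
      (2 * gramForm (innerₗ E) (wedge x' (y t) + wedge (x t) y') (wedge (x t) (y t))) s t := by
  have h := ((hx.inner ℝ hx).mul (hy.inner ℝ hy)).sub ((hx.inner ℝ hy).mul (hx.inner ℝ hy))
  have hfun : (fun τ => gramArea (x τ) (y τ)) =
      ((fun τ => ⟪x τ, x τ⟫_ℝ) * fun τ => ⟪y τ, y τ⟫_ℝ) -
        (fun τ => ⟪x τ, y τ⟫_ℝ) * fun τ => ⟪x τ, y τ⟫_ℝ := by
    funext τ
    simp only [Pi.sub_apply, Pi.mul_apply, gramArea, real_inner_self_eq_norm_sq, sq]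
  rw [hfun]
  refine h.congr_deriv ?_
  simp only [map_add, LinearMap.add_apply, gramForm_wedge, innerₗ_apply_apply, real_inner_comm]
  ring

/-- **The compound equation `ż = A^{[2]} z` tested against `z = x ∧ y`**: if `ẋ = A x` and
`ẏ = A y` at `t` then `d/dt |x ∧ y|² = 2 ⟨A^{[2]}(x ∧ y), x ∧ y⟩`.
[cite: ConstantinFoias1988, Ch. 13 Lemma 13.4] [cite: WuKanevskiyMargaliot2020, §3.1 Proposition 3] -/
theorem hasDerivWithinAt_gramArea_of_ode {A : E →ₗ[ℝ] E} {x y : ℝ → E} {s : Set ℝ} {t : ℝ}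
    (hx : HasDerivWithinAt x (A (x t)) s t) (hy : HasDerivWithinAt y (A (y t)) s t) :
    HasDerivWithinAt (fun τ => gramArea (x τ) (y τ))
      (2 * gramForm (innerₗ E) (secondAdditiveCompound A (wedge (x t) (y t)))
        (wedge (x t) (y t))) s t := by
  rw [secondAdditiveCompound_wedge]
  exact hasDerivWithinAt_gramArea hx hy

/-- **Exponential bound for 2-volumes** (Grönwall on (13.24)): if `x, y` solve `ẋ = A(t) x` on
`[0, T)` (right derivatives, continuous on `[0, T]`) and the quadratic form of `A(t)^{[2]}` satisfies
`⟨A(t)^{[2]} ξ, ξ⟩ ≤ κ |ξ|²` on decomposable `ξ = u ∧ v`, then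
`|x(t) ∧ y(t)|² ≤ |x(0) ∧ y(0)|² e^{2κt}` on `[0, T]`.
[cite: WuKanevskiyMargaliot2020, §3.1 Proposition 3] [cite: ConstantinFoias1988, Ch. 13 (13.29)] -/
theorem gramArea_le_mul_exp {A : ℝ → E →ₗ[ℝ] E} {x y : ℝ → E} {κ T : ℝ}
    (hxc : ContinuousOn x (Icc 0 T)) (hyc : ContinuousOn y (Icc 0 T))
    (hx : ∀ t ∈ Ico 0 T, HasDerivWithinAt x (A t (x t)) (Ici t) t)
    (hy : ∀ t ∈ Ico 0 T, HasDerivWithinAt y (A t (y t)) (Ici t) t)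
    (hA : ∀ t ∈ Ico 0 T, ∀ u v : E,
      gramForm (innerₗ E) (secondAdditiveCompound (A t) (wedge u v)) (wedge u v) ≤
        κ * gramArea u v) :
    ∀ t ∈ Icc 0 T, gramArea (x t) (y t) ≤ gramArea (x 0) (y 0) * Real.exp (2 * κ * t) := by
  have hcont : ContinuousOn (fun τ => gramArea (x τ) (y τ)) (Icc 0 T) := by
    unfold gramArea
    exact ((hxc.norm.pow 2).mul (hyc.norm.pow 2)).sub ((hxc.inner (𝕜 := ℝ) hyc).pow 2)
  have key := le_gronwallBound_of_liminf_deriv_right_le (f := fun τ => gramArea (x τ) (y τ))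
    (f' := fun τ => 2 * gramForm (innerₗ E) (secondAdditiveCompound (A τ) (wedge (x τ) (y τ)))
      (wedge (x τ) (y τ)))
    (δ := gramArea (x 0) (y 0)) (K := 2 * κ) (ε := 0) (a := 0) (b := T) hcont ?_ le_rfl ?_
  · intro t ht
    have h := key t ht
    rwa [gronwallBound_ε0, sub_zero] at h
  · intro t ht r hr
    exact (hasDerivWithinAt_gramArea_of_ode (hx t ht) (hy t ht)).liminf_right_slope_le hr
  · intro t ht
    have h := hA t ht (x t) (y t)
    linarith

/-- **2-contraction from the trace condition** (Proposition 3 for `k = 2` in the Euclidean norm,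
with `μ₂(A^{[2]}) ≤ κ` in its Ky Fan form): if `⟪A(t) u, u⟫ + ⟪A(t) v, v⟫ ≤ κ` for all
`t ∈ [0, T)` and all orthonormal pairs `u, v`, then `|x(t) ∧ y(t)|² ≤ |x(0) ∧ y(0)|² e^{2κt}` for
solutions `x, y` of `ẋ = A(t) x`.
[cite: WuKanevskiyMargaliot2020, §3.1 Proposition 3] [cite: ConstantinFoias1988, Ch. 13 Lemma 13.4] -/
theorem gramArea_le_mul_exp_of_orthonormal {A : ℝ → E →ₗ[ℝ] E} {x y : ℝ → E} {κ T : ℝ}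
    (hxc : ContinuousOn x (Icc 0 T)) (hyc : ContinuousOn y (Icc 0 T))
    (hx : ∀ t ∈ Ico 0 T, HasDerivWithinAt x (A t (x t)) (Ici t) t)
    (hy : ∀ t ∈ Ico 0 T, HasDerivWithinAt y (A t (y t)) (Ici t) t)
    (hA : ∀ t ∈ Ico 0 T, ∀ u v : E, ‖u‖ = 1 → ‖v‖ = 1 → ⟪u, v⟫_ℝ = 0 →
      ⟪A t u, u⟫_ℝ + ⟪A t v, v⟫_ℝ ≤ κ) :
    ∀ t ∈ Icc 0 T, gramArea (x t) (y t) ≤ gramArea (x 0) (y 0) * Real.exp (2 * κ * t) :=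
  gramArea_le_mul_exp hxc hyc hx hy fun t ht u v =>
    gramForm_secondAdditiveCompound_le_of_orthonormal (A t) (hA t ht) u v

/-- **`|x(t) ∧ y(t)| ≤ e^{κt} |x(0) ∧ y(0)|`** — Definition 1 (`2`-order contraction with rate
`η = -κ`) in the Euclidean norm, from the trace condition.
[cite: WuKanevskiyMargaliot2020, §3.1 Definition 1] -/
theorem sqrt_gramArea_le_mul_exp {A : ℝ → E →ₗ[ℝ] E} {x y : ℝ → E} {κ T : ℝ}
    (hxc : ContinuousOn x (Icc 0 T)) (hyc : ContinuousOn y (Icc 0 T))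
    (hx : ∀ t ∈ Ico 0 T, HasDerivWithinAt x (A t (x t)) (Ici t) t)
    (hy : ∀ t ∈ Ico 0 T, HasDerivWithinAt y (A t (y t)) (Ici t) t)
    (hA : ∀ t ∈ Ico 0 T, ∀ u v : E, ‖u‖ = 1 → ‖v‖ = 1 → ⟪u, v⟫_ℝ = 0 →
      ⟪A t u, u⟫_ℝ + ⟪A t v, v⟫_ℝ ≤ κ) :
    ∀ t ∈ Icc 0 T,
      Real.sqrt (gramArea (x t) (y t)) ≤ Real.sqrt (gramArea (x 0) (y 0)) * Real.exp (κ * t) := by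
  intro t ht
  have h := gramArea_le_mul_exp_of_orthonormal hxc hyc hx hy hA t ht
  have hexp : Real.exp (2 * κ * t) = Real.exp (κ * t) ^ 2 := by
    rw [← Real.exp_nat_mul]
    congr 1
    push_cast
    ring
  calc Real.sqrt (gramArea (x t) (y t))
      ≤ Real.sqrt (gramArea (x 0) (y 0) * Real.exp (2 * κ * t)) := Real.sqrt_le_sqrt h
    _ = Real.sqrt (gramArea (x 0) (y 0)) * Real.exp (κ * t) := by
        rw [Real.sqrt_mul (gramArea_nonneg _ _), hexp, Real.sqrt_sq (Real.exp_pos _).le]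

end InnerProduct

/-! ### Spectral consequence: sums of eigenvalues are eigenvalues of `f^{[2]}` -/

section Spectral

variable {K : Type*} [Field K] {V : Type*} [AddCommGroup V] [Module K V]

/-- Over a field, **`x ∧ y ≠ 0` for linearly independent `x, y`** (a member of the linearly
independent family of `2`-fold wedges of an independent family, Mathlib's
`exteriorPower.ιMulti_family_linearIndependent_field`). [folklore] -/
theorem wedge_ne_zero_of_linearIndependent {x y : V} (h : LinearIndependent K ![x, y]) :
    wedge (R := K) x y ≠ 0 := by
  have hli := exteriorPower.ιMulti_family_linearIndependent_field (n := 2) h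
  have hs := hli.ne_zero (powersetCard.ofFinEmbEquiv (OrderIso.refl (Fin 2)).toOrderEmbedding)
  rw [exteriorPower.ιMulti_family, Equiv.symm_apply_apply] at hs
  have hfun : (![x, y] ∘ ⇑((OrderIso.refl (Fin 2)).toOrderEmbedding)) = ![x, y] := by
    funext i
    rfl
  rwa [hfun] at hs

/-- **Sums of eigenvalues are eigenvalues of the second additive compound**: if `x, y` are linearly
independent eigenvectors of `f` with eigenvalues `a, b`, then `a + b` is an eigenvalue of `f^{[2]}`,
with eigenvector `x ∧ y` — the inclusion `{λᵢ + λⱼ : i < j} ⊆ σ(A^{[2]})` of the spectral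
description of `A^{[2]}` (equality in finite dimensions over an algebraically closed field).
[cite: WuKanevskiyMargaliot2020, §2.3] [cite: Muldowney1990, §2] -/
theorem hasEigenvalue_secondAdditiveCompound (f : Module.End K V) {a b : K} {x y : V}
    (hx : f.HasEigenvector a x) (hy : f.HasEigenvector b y) (hxy : LinearIndependent K ![x, y]) :
    Module.End.HasEigenvalue (secondAdditiveCompound f) (a + b) := by
  refine Module.End.hasEigenvalue_of_hasEigenvector (x := wedge x y) ⟨?_, ?_⟩
  · rw [Module.End.mem_eigenspace_iff]
    exact secondAdditiveCompound_wedge_of_eigen f (Module.End.mem_eigenspace_iff.mp hx.1)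
      (Module.End.mem_eigenspace_iff.mp hy.1)
  · exact wedge_ne_zero_of_linearIndependent hxy

end Spectral

end Literature.Dynamics.Contraction
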